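import Mathlib
import HarnessLib

/-!
# Marczewski's compact-class theorem: inner-regular contents on a ring of sets extend to measures

**Theorem** (E. Marczewski 1953; J. Neveu, *Bases mathématiques du calcul des probabilités* (1964) Prop. I.6.2;
here from [cite: Bogachev2007, Thm. 1.4.3] — V. I. Bogachev, *Measure Theory* I, Springer 2007, §1.4 «Compact classes
and countable additivity»).  Let `R` be a ring of subsets of `α`, `m` a finite-valued additive content on `R`, and
`K ⊆ R` a COMPACT SYSTEM (every countable subfamily with empty intersection has a finite subfamily with empty
intersection; e.g. the compact subsets of a Hausdorff space, `isCompactSystem_isCompact`).  If `m` is inner regular with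
respect to `K` — `m(s ∖ k) ≤ ε` for some `k ∈ K`, `k ⊆ s`, for every `s ∈ R`, `ε > 0` — then `m` is continuous at `∅`
along antitone sequences (`AddContent.tendsto_zero_of_innerRegular`), hence countably additive and σ-subadditive on `R`
(`AddContent.isSigmaSubadditive_of_innerRegular`), so Mathlib's Carathéodory construction `AddContent.measure` extends it
to a measure on `σ(R)` agreeing with `m` on `R`.

Mathlib has compact systems (`IsCompactSystem`) and the Carathéodory extension of σ-subadditive contents
(`MeasureTheory/OuterMeasure/OfAddContent.lean`) but not this bridge.  THEOREMS ONLY; no `sorry`; standard axioms.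
Motivation in the tree: assembling a measure on `[0,∞) × ℝ³` from the positive bimeasure of Laplace–Fourier slices
(crux ⟨stmt-QuantumFields-23125⟩, stub `stub_laplaceFourier`).

## References
* V. I. Bogachev, *Measure Theory*, Vol. I, Springer (2007), §1.4, Thm. 1.4.3. [Bogachev2007]
* E. Marczewski, *On compact measures*, Fund. Math. 40 (1953) 113–124.
-/

noncomputable section

open MeasureTheory Set Filter Topology
open scoped ENNReal

namespace Literature.MeasureTheory.Radon

variable {α : Type*} {R K : Set (Set α)}

/-- **Compact-class continuity at `∅`** (Marczewski): a finite-valued additive content on a ring `R`, inner regular with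
respect to a compact system `K ⊆ R`, tends to `0` along every antitone sequence in `R` with empty intersection.
[cite: Bogachev2007, Thm. 1.4.3] -/
theorem AddContent.tendsto_zero_of_innerRegular (hR : IsSetRing R) (m : AddContent ℝ≥0∞ R)
    (hK : IsCompactSystem K) (hKR : K ⊆ R)
    (hreg : ∀ s ∈ R, ∀ ε : ℝ≥0∞, 0 < ε → ∃ k ∈ K, k ⊆ s ∧ m (s \ k) ≤ ε)
    {s : ℕ → Set α} (hs : ∀ n, s n ∈ R) (hanti : Antitone s) (hempty : ⋂ n, s n = ∅) :
    Tendsto (fun n => m (s n)) atTop (𝓝 0) := by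
  rw [ENNReal.tendsto_atTop_zero]
  intro ε hε
  -- a summable error budget
  obtain ⟨δ, hδpos, hδsum⟩ := ENNReal.exists_pos_sum_of_countable hε.ne' ℕ
  -- inner approximants from the compact system
  have hk : ∀ i, ∃ k ∈ K, k ⊆ s i ∧ m (s i \ k) ≤ δ i := fun i =>
    hreg (s i) (hs i) (δ i) (ENNReal.coe_pos.2 (hδpos i))
  choose k hkK hks hkm using hk
  -- their intersection is empty, so finitely many of them already have empty intersection
  have hkempty : ⋂ i, k i = ∅ :=
    Set.eq_empty_of_subset_empty (hempty ▸ Set.iInter_mono hks)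
  obtain ⟨N, hN⟩ := hK k hkK hkempty
  refine ⟨N, fun n hn => ?_⟩
  -- `s n ⊆ s N ⊆ ⋃_{i ≤ N} (s i \ k i)`
  have hsub : s N ⊆ ⋃ i ∈ Finset.range (N + 1), (s i \ k i) := by
    intro x hx
    have hx' : x ∉ Set.dissipate k N := by rw [hN]; exact Set.notMem_empty x
    simp only [Set.mem_dissipate, not_forall] at hx'
    obtain ⟨i, hi, hxi⟩ := hx'
    exact Set.mem_biUnion (Finset.mem_range.2 (Nat.lt_succ_of_le hi)) ⟨hanti hi hx, hxi⟩
  have hdiff : ∀ i, s i \ k i ∈ R := fun i => hR.sdiff_mem (hs i) (hKR (hkK i))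
  calc m (s n) ≤ m (s N) := addContent_mono hR.isSetSemiring (hs n) (hs N) (hanti hn)
    _ ≤ m (⋃ i ∈ Finset.range (N + 1), (s i \ k i)) :=
        addContent_mono hR.isSetSemiring (hs N) (hR.biUnion_mem _ fun i _ => hdiff i) hsub
    _ ≤ ∑ i ∈ Finset.range (N + 1), m (s i \ k i) := addContent_biUnion_le hR fun i _ => hdiff i
    _ ≤ ∑ i ∈ Finset.range (N + 1), (δ i : ℝ≥0∞) := Finset.sum_le_sum fun i _ => hkm i
    _ ≤ ∑' i, (δ i : ℝ≥0∞) := ENNReal.sum_le_tsum _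
    _ ≤ ε := hδsum.le

/-- **Compact-class σ-subadditivity** (Marczewski): a finite-valued additive content on a ring, inner regular with respect
to a compact system contained in the ring, is countably additive, hence σ-subadditive — so `AddContent.measure`
(Carathéodory) extends it. [cite: Bogachev2007, Thm. 1.4.3] -/
theorem AddContent.isSigmaSubadditive_of_innerRegular (hR : IsSetRing R) (m : AddContent ℝ≥0∞ R)
    (hfin : ∀ s ∈ R, m s ≠ ∞) (hK : IsCompactSystem K) (hKR : K ⊆ R)
    (hreg : ∀ s ∈ R, ∀ ε : ℝ≥0∞, 0 < ε → ∃ k ∈ K, k ⊆ s ∧ m (s \ k) ≤ ε) :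
    m.IsSigmaSubadditive :=
  isSigmaSubadditive_of_addContent_iUnion_eq_tsum hR fun _ hf hUf hdisj =>
    addContent_iUnion_eq_sum_of_tendsto_zero hR m hfin
      (fun _ hs hanti hempty => AddContent.tendsto_zero_of_innerRegular hR m hK hKR hreg hs hanti hempty) hf hUf hdisj

/-- **Extension to a measure** (Marczewski + Carathéodory): under the hypotheses of
`AddContent.isSigmaSubadditive_of_innerRegular`, if the ring `R` generates the σ-algebra, there is a measure agreeing with
`m` on `R`. [cite: Bogachev2007, Thm. 1.4.3] -/
theorem AddContent.exists_measure_eq_of_innerRegular [mα : MeasurableSpace α] (hR : IsSetRing R)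
    (m : AddContent ℝ≥0∞ R) (hfin : ∀ s ∈ R, m s ≠ ∞) (hK : IsCompactSystem K) (hKR : K ⊆ R)
    (hreg : ∀ s ∈ R, ∀ ε : ℝ≥0∞, 0 < ε → ∃ k ∈ K, k ⊆ s ∧ m (s \ k) ≤ ε)
    (hgen : mα = MeasurableSpace.generateFrom R) :
    ∃ μ : Measure α, ∀ s ∈ R, μ s = m s :=
  ⟨m.measure hR.isSetSemiring hgen.le (AddContent.isSigmaSubadditive_of_innerRegular hR m hfin hK hKR hreg),
    fun _ hs => AddContent.measure_eq m hR.isSetSemiring hgen _ hs⟩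

end Literature.MeasureTheory.Radon

end
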